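import Summits.Langlands.Langlands.Theorems.PhantomRMYoshidaResiduallyYoshidaLiftingKlingenReduction
import HarnessLib

/-!
# Route `PhantomRMYoshida`, crux `ResiduallyYoshidaLifting` (stmt-Langlands-13639): glue of the
# route-level SECTOR split of the Klingen layers
# (`KlingenDensityGeneric` / `KlingenLimitClassicality` / `KlingenDensityCorner`)

Lead prover-line-stmt-Langlands-13639-c2-0 (2026-08-17), line `sector-klingen-split`, registered stub
`stub_sectorSplit` (`--supports stmt-Langlands-13639`).

The crux strategist (planner-cstrat-stmt-Langlands-13639-p1-0) decomposed the crux into three sub-cruxes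
(`Cruxes/ResiduallyYoshidaLifting/STRATEGY-CENSUS.md` §6; `children.json` attached as evidence on the crux
item).  Over the landed Klingen reduction (p116982: `EveryShIsKlingenLimit` = KL1,
`KlingenLimitClassicality` = KL2, `residuallyYoshidaLifting_of_klingen : KL1 → KL2 → crux`,
`phantomRMSector_iff_klingen : PhantomRMSector ↔ (KL1 ∧ KL2)`) the split cuts KL1 by the RESIDUAL SECTOR
of the pair `(σ̄, σ̄')`:

* `GenericSector p k σ σ'` — `5 ≤ p`, both constituents absolutely irreducible on `Γ_{ℚ(ζ_p)}`, and `σ̄'`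
  not a (pointwise-scalar) twist of `σ̄`;
* `KlingenDensityGeneric` — KL1 restricted to the generic sector (intended sub-crux 1, the open core);
* `KlingenDensityCorner` — KL1 off the generic sector (intended sub-crux 3: `p = 3`, a constituent
  absolutely reducible on `Γ_{ℚ(ζ_p)}`, or a twist pair — the corner where line C died, p96414);
* sub-crux 2 is KL2 = `KlingenLimitClassicality` itself (p116982).

This file is the PROVER-READY GLUE for `ledger route edit … --split … --glue-by`: it DEFINES the sector
and the two sector statements (verbatim the checked skeleton `Lines/sector_klingen_split.lean`, namespace
changed from `…SectorKlingenSplit` to `…SectorSplit`) and proves, by pure logic over p116982 (classical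
case split on the sector; no `sorry`, no new axioms):

* `everyShIsKlingenLimit_of_sectors : KlingenDensityGeneric → KlingenDensityCorner → EveryShIsKlingenLimit`;
* `everyShIsKlingenLimit_iff_sectors :
    EveryShIsKlingenLimit ↔ (KlingenDensityGeneric ∧ KlingenDensityCorner)`;
* **`stub_sectorSplit`** (registered) and its route-level name `ResiduallyYoshidaLifting_of_subs :
    KlingenDensityGeneric → KlingenLimitClassicality → KlingenDensityCorner → ResiduallyYoshidaLifting`;
* `phantomRMSector_iff_subs :
    PhantomRMSector ↔ (KlingenDensityGeneric ∧ KlingenLimitClassicality ∧ KlingenDensityCorner)` —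
  the decomposition is EXACT w.r.t. the route target (no excess over the target, unlike line A's
  `EveryShIsLimit` split, standing disprover's T8), with the three one-way corollaries
  `klingenDensityGeneric_of_phantomRMSector`, `klingenLimitClassicality_of_phantomRMSector` (p116982),
  `klingenDensityCorner_of_phantomRMSector`.

What is NOT claimed: none of the three sub-crux statements is proved here, and none is in print at a
residually split Yoshida `𝔪` (five concordant dossiers; census §1, §3 F1–F3).  `KlingenDensityGeneric`
and `KlingenDensityCorner` are OPEN statements of this crux (conjecture-grade, implied by the route target
via `phantomRMSector_iff_subs`); like KL1/KL2 in p116982 they deliberately carry no citation tag and must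
not be relocated to `Literature/`.
-/

noncomputable section

-- `Summit.Langlands.Langlands.…` (summit = sub-problem name, D-0017 layout) trips `dupNamespace` on every decl.
set_option linter.dupNamespace false
set_option autoImplicit false

open IsDedekindDomain Filter
open Literature.NumberTheory.GaloisRepresentations Literature.NumberTheory.Automorphic
open Summit.Langlands.Langlands.Cruxes.ResiduallyYoshidaLifting.YoshidaDivisorSelmerCount

namespace Summit.Langlands.Langlands.Cruxes.ResiduallyYoshidaLifting.SectorSplit

/-! ## The residual sector and the two sector statements (OPEN; the intended sub-cruxes 1 and 3) -/

/-- **The generic residual sector** of an admissible residual pair `(σ̄, σ̄')`: `p ≥ 5`, both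
constituents absolutely irreducible on `Γ_{ℚ(ζ_p)}` (Mathlib model `CyclotomicField p ℚ` of `ℚ(ζ_p)`),
and `σ̄'` not a character twist of `σ̄` (pointwise-scalar form: `g σ̄ g⁻¹ = c(·) • σ̄'` is excluded for
every `g`; such a `c` is automatically a character).  A definition (the case distinction of the split),
not a claim; verbatim the skeleton's `GenericSector`. -/
def GenericSector (p : ℕ) (k : Type) [Field k] [TopologicalSpace k] [DiscreteTopology k]
    (σ σ' : FramedGaloisRep ℚ k 2) : Prop :=
  5 ≤ p ∧ FramedRep.IsAbsolutelyIrreducible (FramedGaloisRep.restrictField (CyclotomicField p ℚ) σ) ∧ FramedRep.IsAbsolutelyIrreducible (FramedGaloisRep.restrictField (CyclotomicField p ℚ) σ') ∧ ¬ ∃ g : GL (Fin 2) k, ∀ x, ∃ c : k, (g * σ x * g⁻¹).val = c • (σ' x).val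

/-- **`KlingenDensityGeneric` — KL1 on the generic sector** (intended sub-crux 1 of the split, the open
core): on every admissible residual fibre (`σ̄, σ̄'` irreducible, non-conjugate, `det σ̄ = det σ̄' = ε̄⁻¹`)
IN THE GENERIC SECTOR, every irreducible `ρ` with `Sh ρ` is a Klingen classical limit.  Same binders as
`EveryShIsKlingenLimit` (p116982) plus the hypothesis `GenericSector p k σ σ'`.  Its intended reading is
Klingen/ordinary pro-automorphy at a residually SPLIT Yoshida maximal ideal, OPEN IN PRINT; implied by
the route target (`klingenDensityGeneric_of_phantomRMSector`)
(open statement of this crux; deliberately no citation tag, must not be relocated to Literature/). -/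
def KlingenDensityGeneric : Prop :=
  ∀ (p : ℕ) [Fact p.Prime], p ≠ 2 → ∀ (k : Type) [Field k] [CharP k p] [IsAlgClosed k]
    [TopologicalSpace k] [DiscreteTopology k] (red : Valued.integer (PadicAlgCl p) →+* k)
    (σ σ' : FramedGaloisRep ℚ k 2) (hcpt : isCompact_glFiniteIntegralLevel 4 ℚ) (ι : PadicAlgCl p ≃+* ℂ)
    (ρ : FramedGaloisRep ℚ (PadicAlgCl p) 4),
    σ.toGaloisRep.IsIrreducible → σ'.toGaloisRep.IsIrreducible → DetC p k σ σ' →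
    (¬ ∃ g : GL (Fin 2) k, ∀ x, g * σ x * g⁻¹ = σ' x) → GenericSector p k σ σ' →
    ρ.toGaloisRep.IsIrreducible → Sh p k red σ σ' ρ → IsKlingenClassicalLimit p hcpt ι ρ

/-- **`KlingenDensityCorner` — KL1 off the generic sector** (intended sub-crux 3 of the split; the named
residue of conjunct (B): `p = 3`, or a constituent absolutely reducible on `Γ_{ℚ(ζ_p)}`, or a twist
pair — exactly the corner where line C's cross-regular element failed, p96414).  Same binders as
`EveryShIsKlingenLimit` (p116982) plus the hypothesis `¬ GenericSector p k σ σ'`; implied by the route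
target (`klingenDensityCorner_of_phantomRMSector`)
(open statement of this crux; deliberately no citation tag, must not be relocated to Literature/). -/
def KlingenDensityCorner : Prop :=
  ∀ (p : ℕ) [Fact p.Prime], p ≠ 2 → ∀ (k : Type) [Field k] [CharP k p] [IsAlgClosed k]
    [TopologicalSpace k] [DiscreteTopology k] (red : Valued.integer (PadicAlgCl p) →+* k)
    (σ σ' : FramedGaloisRep ℚ k 2) (hcpt : isCompact_glFiniteIntegralLevel 4 ℚ) (ι : PadicAlgCl p ≃+* ℂ)
    (ρ : FramedGaloisRep ℚ (PadicAlgCl p) 4),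
    σ.toGaloisRep.IsIrreducible → σ'.toGaloisRep.IsIrreducible → DetC p k σ σ' →
    (¬ ∃ g : GL (Fin 2) k, ∀ x, g * σ x * g⁻¹ = σ' x) → ¬ GenericSector p k σ σ' →
    ρ.toGaloisRep.IsIrreducible → Sh p k red σ σ' ρ → IsKlingenClassicalLimit p hcpt ι ρ

/-! ## The sector case split: the two sector statements are exactly KL1 -/

/-- **KL1 from its two sector pieces** (classical case split on `GenericSector p k σ σ'`). -/
theorem everyShIsKlingenLimit_of_sectors :
    KlingenDensityGeneric → KlingenDensityCorner → EveryShIsKlingenLimit := by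
  intro h₁ h₃ p _ hp k _ _ _ _ _ red σ σ' hcpt ι ρ hσ hσ' hdet hnc hρ hSh
  by_cases hG : GenericSector p k σ σ'
  · exact h₁ p hp k red σ σ' hcpt ι ρ hσ hσ' hdet hnc hG hρ hSh
  · exact h₃ p hp k red σ σ' hcpt ι ρ hσ hσ' hdet hnc hG hρ hSh

/-- **The two sector pieces are exactly KL1**:
`EveryShIsKlingenLimit ↔ (KlingenDensityGeneric ∧ KlingenDensityCorner)` (each piece is KL1 with one
extra, unused hypothesis; conversely the case split `everyShIsKlingenLimit_of_sectors`). -/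
theorem everyShIsKlingenLimit_iff_sectors :
    EveryShIsKlingenLimit ↔ (KlingenDensityGeneric ∧ KlingenDensityCorner) :=
  ⟨fun h => ⟨fun p _ hp k _ _ _ _ _ red σ σ' hcpt ι ρ hσ hσ' hdet hnc _ hρ hSh =>
      h p hp k red σ σ' hcpt ι ρ hσ hσ' hdet hnc hρ hSh,
    fun p _ hp k _ _ _ _ _ red σ σ' hcpt ι ρ hσ hσ' hdet hnc _ hρ hSh =>
      h p hp k red σ σ' hcpt ι ρ hσ hσ' hdet hnc hρ hSh⟩,
   fun h => everyShIsKlingenLimit_of_sectors h.1 h.2⟩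

/-! ## Glue: the crux from the three sub-cruxes, and exactness w.r.t. the route target -/

/-- **Registered stub `stub_sectorSplit`** (`--supports stmt-Langlands-13639`, line
`sector-klingen-split`): sub-crux 1 (`KlingenDensityGeneric`) → sub-crux 2 (`KlingenLimitClassicality`,
p116982) → sub-crux 3 (`KlingenDensityCorner`) → the crux `ResiduallyYoshidaLifting`.  Pure logic: the
sector case split `everyShIsKlingenLimit_of_sectors` followed by the landed Klingen glue
`residuallyYoshidaLifting_of_klingen` (p116982). -/
theorem stub_sectorSplit : KlingenDensityGeneric → KlingenLimitClassicality → KlingenDensityCorner → Summit.Langlands.Langlands.Theses.PhantomRMYoshida.ResiduallyYoshidaLifting :=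
  fun h₁ h₂ h₃ => residuallyYoshidaLifting_of_klingen (everyShIsKlingenLimit_of_sectors h₁ h₃) h₂

/-- **`ResiduallyYoshidaLifting_of_subs`** — the glue under its route-level name (the `--glue-by`
declaration of the split): the three sub-cruxes, in the order generic density / limit classicality /
corner density, imply the crux.  Identical statement to `stub_sectorSplit`. -/
theorem ResiduallyYoshidaLifting_of_subs : KlingenDensityGeneric → KlingenLimitClassicality → KlingenDensityCorner → Summit.Langlands.Langlands.Theses.PhantomRMYoshida.ResiduallyYoshidaLifting :=
  stub_sectorSplit

/-- **The split is EXACT w.r.t. the route target**: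
`PhantomRMSector ↔ (KlingenDensityGeneric ∧ KlingenLimitClassicality ∧ KlingenDensityCorner)` — from
`phantomRMSector_iff_klingen` (p116982) and `everyShIsKlingenLimit_iff_sectors`. -/
theorem phantomRMSector_iff_subs :
    Summit.Langlands.Langlands.Theses.PhantomRMYoshida.PhantomRMSector ↔
      (KlingenDensityGeneric ∧ KlingenLimitClassicality ∧ KlingenDensityCorner) := by
  rw [phantomRMSector_iff_klingen, everyShIsKlingenLimit_iff_sectors]; tauto

/-- **target ⟹ sub-crux 1**: `KlingenDensityGeneric` carries no risk beyond the route target. -/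
theorem klingenDensityGeneric_of_phantomRMSector
    (h : Summit.Langlands.Langlands.Theses.PhantomRMYoshida.PhantomRMSector) :
    KlingenDensityGeneric :=
  (phantomRMSector_iff_subs.1 h).1

/-- **target ⟹ sub-crux 3**: `KlingenDensityCorner` carries no risk beyond the route target. -/
theorem klingenDensityCorner_of_phantomRMSector
    (h : Summit.Langlands.Langlands.Theses.PhantomRMYoshida.PhantomRMSector) :
    KlingenDensityCorner :=
  (phantomRMSector_iff_subs.1 h).2.2

/-- **The three sub-cruxes ⟹ the route target** (the split is absolute: the relative datum `ρ₀` of the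
crux is not consumed), via `phantomRMSector_of_klingen` (p116982). -/
theorem phantomRMSector_of_subs (h₁ : KlingenDensityGeneric) (h₂ : KlingenLimitClassicality)
    (h₃ : KlingenDensityCorner) :
    Summit.Langlands.Langlands.Theses.PhantomRMYoshida.PhantomRMSector :=
  phantomRMSector_of_klingen (everyShIsKlingenLimit_of_sectors h₁ h₃) h₂

end Summit.Langlands.Langlands.Cruxes.ResiduallyYoshidaLifting.SectorSplit

end
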